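import Literature.NumberTheory.EllipticCurves.TateCurve.TatePointHom
import Literature.NumberTheory.EllipticCurves.TateCurve.UniformizationPartner
import Literature.NumberTheory.EllipticCurves.TateCurve.UniformizationResidueUnits
import Literature.NumberTheory.EllipticCurves.TateCurve.UniformizationChord
import Mathlib.Analysis.Normed.Ring.Ultra
import HarnessLib

/-!
# Tate's map `φ : Kˣ → E_q(K)` is surjective (Silverman, *Advanced Topics*, Thm. V.3.1 (c) /
# §V.4, PDF pp. 399–405) — the assembly over a complete ultrametric field

Topic `Literature/NumberTheory/EllipticCurves/TateCurve`, namespace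
`Literature.NumberTheory.EllipticCurves.TateCurve` (abc-iut cell, TRANCHE-T1 P21; sub-lemma U-8 of
the discharge plan of the named fact `uniformization`).

Silverman proves the surjectivity of `φ : K^* → E_q(K)` in §V.4 through the filtration
`E_{q,1}(K) ⊂ E_{q,0}(K) ⊂ E_q(K)` (PDF pp. 399–405): Lemma V.4.1.1 (`φ(1 + 𝔪) = E_{q,1}`),
Lemma V.4.1.2 (`φ(R^*) = E_{q,0}`), Lemma V.4.1.3/V.4.1.4 (every point off `E_{q,0}` differs from
some `φ(u)`, `|q| < |u| < 1`, by a point of `E_{q,0}`). In the tree these are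

* abc-iut-L6-t5's `exists_units_tate_eq_of_one_le_norm` (`UniformizationResidueUnits.lean`,
  block B): every `(x, y) ∈ E_q(K)` with `‖x‖ ≥ 1` is `(X(u,q), Y(u,q))` for some `u ∈ Kˣ ∖ q^ℤ`;
* abc-iut-L2-t6's `exists_partner_dichotomy` (`UniformizationPartner.lean`, block A): every
  `(x, y) ∈ E_q(K)` with `‖x‖ < 1` is either `φ(u)` for some `u` in the fundamental annulus
  `‖q‖ < ‖u‖ < 1`, or `x(P − φ(u))` has norm `≥ 1` (chord formula `UniformizationChord.lean`);
* the homomorphism `tatePoint_mul` (`TatePointHom.lean`) to conclude `P = φ(w) + φ(u) = φ(wu)`.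

Main results (any complete ultrametric field `K` of characteristic `0`, `0 < ‖q‖ < 1`):

* `exists_tatePoint_eq_of_one_le_norm` : `E_{q,0}(K) ⊆ φ(Kˣ)` (unconditional);
* **`tatePoint_surjective`** : `φ : Kˣ → E_q(K)` is onto — modulo the two formal addition
  identities `addRelX = 0`, `addRelY = 0` of `TateFormalAddition.lean` (abc-iut-L6-t14), the
  hypotheses of `tatePoint_mul`.

No discreteness of the valuation is used anywhere (blocks A and B are valuation-theoretic).

## References
* [SilvermanATAEC1994] J. H. Silverman, *Advanced Topics in the Arithmetic of Elliptic Curves*,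
  GTM 151, Springer 1994, Thm. V.3.1 (c) (PDF pp. 395–399) and §V.4, Lemmas V.4.1.1–V.4.1.4
  (PDF pp. 399–405).
-/

noncomputable section

open scoped Classical

namespace Literature.NumberTheory.EllipticCurves.TateCurve

open SteinWuthrich2013 WeierstrassCurve

universe u

variable {K : Type u} [NontriviallyNormedField K] [CompleteSpace K] [IsUltrametricDist K]
  [CharZero K] {q : K}

omit [CompleteSpace K] [IsUltrametricDist K] in
/-- `12 ≠ 0` in characteristic `0`. [folklore] -/
private theorem twelve_ne_zero'' : (12 : K) ≠ 0 := by norm_num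

omit [CompleteSpace K] [IsUltrametricDist K] [CharZero K] in
/-- The Weierstrass equation of `E_q` in expanded form. [cite: SilvermanATAEC1994, Thm. V.3.1 (PDF p. 395)] -/
private theorem eq_of_nonsingular {x y : K} (h : (tateCurve q).toAffine.Nonsingular x y) :
    y ^ 2 + x * y = x ^ 3 + tateA4 q * x + tateA6 q := by
  have h' := h.1
  rw [WeierstrassCurve.Affine.equation_iff] at h'
  simp only [tateCurve] at h'
  linear_combination h'

omit [IsUltrametricDist K] in
/-- `φ(Kˣ ∖ q^ℤ) ⊆ E_q(K)` in equation form (`tate_onCurve` of `TateFormalIdentity.lean`, `12 ≠ 0`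
automatic in characteristic `0`). [cite: SilvermanATAEC1994, Thm. V.3.1 (c) (PDF pp. 395–397)] -/
theorem tate_onCurve' (hq0 : q ≠ 0) (hq : ‖q‖ < 1) (u : Kˣ) (hu : ∀ n : ℤ, (u : K) ≠ q ^ n) :
    tateY q (u : K) ^ 2 + tateX q (u : K) * tateY q (u : K)
      = tateX q (u : K) ^ 3 + tateA4 q * tateX q (u : K) + tateA6 q :=
  tate_onCurve hq0 hq twelve_ne_zero'' u hu

/-- **`E_{q,0}(K) ⊆ φ(Kˣ)`** (ATAEC Lemma V.4.1.2 with V.4.1.1, abc-iut-L6-t5's block B): every point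
`(x, y)` of `E_q(K)` with `‖x‖ ≥ 1` is `φ(u)` for some `u ∈ Kˣ` (indeed a unit `u ∉ q^ℤ`).
[cite: SilvermanATAEC1994, Lemma V.4.1.2 (PDF pp. 401–403)] -/
theorem exists_tatePoint_eq_of_one_le_norm (hq0 : q ≠ 0) (hq : ‖q‖ < 1) {x y : K}
    (h : (tateCurve q).toAffine.Nonsingular x y) (hx : 1 ≤ ‖x‖) :
    ∃ u : Kˣ, tatePoint q u = .some x y h := by
  obtain ⟨u, hu, hX, hY⟩ := exists_units_tate_eq_of_one_le_norm twelve_ne_zero'' hq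
    (fun u hu => tate_onCurve' hq0 hq u hu) (eq_of_nonsingular h) hx
  refine ⟨u, ?_⟩
  rw [tatePoint_of_ne_zpow hq0 hq u hu]
  simp only [Affine.Point.some.injEq]
  exact ⟨hX, hY⟩

omit [CompleteSpace K] [CharZero K] in
/-- `‖2x‖ < 1` when `‖x‖ < 1` (ultrametric: `‖2‖ ≤ 1`). [folklore] -/
private theorem norm_two_mul_lt_one {x : K} (hx : ‖x‖ < 1) : ‖-x - x‖ < 1 := by
  rw [show -x - x = -(2 * x) by ring, norm_neg, norm_mul]
  calc ‖(2 : K)‖ * ‖x‖ ≤ 1 * ‖x‖ := by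
        apply mul_le_mul_of_nonneg_right _ (norm_nonneg x)
        exact_mod_cast IsUltrametricDist.norm_natCast_le_one K 2
    _ < 1 := by rw [one_mul]; exact hx

/-- **Silverman ATAEC Thm. V.3.1 (c), surjectivity part: `φ : Kˣ → E_q(K)` is onto** for every
complete ultrametric field `K` of characteristic `0` and `0 < ‖q‖ < 1` (§V.4: `O = φ(1)`; a point
with `‖x‖ ≥ 1` lies in `E_{q,0} = φ(R^*)`; a point `P` with `‖x‖ < 1` is `φ(u)` for a level partner
`u`, or `P − φ(u) ∈ E_{q,0} = φ(R^*)` and `P = φ(w) + φ(u) = φ(wu)`) — modulo the two formal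
addition identities `addRelX = 0`, `addRelY = 0` (hypotheses of `tatePoint_mul`).
[cite: SilvermanATAEC1994, Thm. V.3.1 (c) (PDF p. 399), §V.4 (PDF pp. 399–405)] -/
theorem tatePoint_surjective (hX : addRelX = 0) (hY : addRelY = 0) (hq0 : q ≠ 0) (hq : ‖q‖ < 1) :
    Function.Surjective (tatePoint q : Kˣ → (tateCurve q).toAffine.Point) := by
  intro P
  rcases P with _ | ⟨x, y, h⟩
  · exact ⟨1, tatePoint_of_eq_zpow 1 (n := 0) (by simp)⟩
  by_cases hx1 : 1 ≤ ‖x‖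
  · exact exists_tatePoint_eq_of_one_le_norm hq0 hq h hx1
  push Not at hx1
  have heq := eq_of_nonsingular h
  have hon : ∀ u : K, ‖q‖ < ‖u‖ → ‖u‖ < 1 →
      tateY q u ^ 2 + tateX q u * tateY q u = tateX q u ^ 3 + tateA4 q * tateX q u + tateA6 q := by
    intro u hqu hu1
    have hu0 : u ≠ 0 := norm_pos_iff.mp ((norm_nonneg q).trans_lt hqu)
    exact tate_onCurve' hq0 hq (Units.mk0 u hu0) (ne_zpow_of_norm_lt_of_lt hqu hu1)
  obtain ⟨u, hqu, hu1, hdich⟩ := exists_partner_dichotomy twelve_ne_zero'' hq0 hq hon heq hx1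
  have hu0 : u ≠ 0 := norm_pos_iff.mp ((norm_nonneg q).trans_lt hqu)
  set v : Kˣ := Units.mk0 u hu0 with hvdef
  have hv : ∀ n : ℤ, (v : K) ≠ q ^ n := ne_zpow_of_norm_lt_of_lt hqu hu1
  have hnsv : (tateCurve q).toAffine.Nonsingular (tateX q u) (tateY q u) :=
    tatePoint_nonsingular hq0 hq v hv
  have hφv : tatePoint q v = .some (tateX q u) (tateY q u) hnsv := by
    rw [tatePoint_of_ne_zpow hq0 hq v hv]; rfl
  rcases hdich with ⟨hxX, hyY⟩ | hchord
  · -- `P = φ(u)` on the nose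
    refine ⟨v, ?_⟩
    rw [hφv]
    simp only [Affine.Point.some.injEq]
    exact ⟨hxX.symm, hyY.symm⟩
  · -- `P − φ(u) ∈ E_{q,0}`
    have hxne : x ≠ tateX q u := by
      intro hxe
      rw [← hxe, sub_self, div_zero, zero_pow two_ne_zero, zero_add, zero_sub] at hchord
      exact absurd hchord (not_le.mpr (norm_two_mul_lt_one hx1))
    have hnsneg : (tateCurve q).toAffine.Nonsingular (tateX q u)
        ((tateCurve q).toAffine.negY (tateX q u) (tateY q u)) :=
      (Affine.nonsingular_neg _ _).mpr hnsv
    set ℓ := (tateCurve q).toAffine.slope x (tateX q u) y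
      ((tateCurve q).toAffine.negY (tateX q u) (tateY q u)) with hℓ
    have hns : (tateCurve q).toAffine.Nonsingular ((tateCurve q).toAffine.addX x (tateX q u) ℓ)
        ((tateCurve q).toAffine.addY x (tateX q u) y ℓ) :=
      Affine.nonsingular_add h hnsneg (fun hh => hxne hh.1)
    have hsum : Affine.Point.some x y h + -tatePoint q v = .some _ _ hns := by
      rw [hφv, Affine.Point.neg_some, Affine.Point.add_of_X_ne hxne]
    have hx' : 1 ≤ ‖(tateCurve q).toAffine.addX x (tateX q u) ℓ‖ := by
      rw [hℓ, tateCurve_addX_slope_negY hxne]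
      exact hchord
    obtain ⟨w, hw⟩ := exists_tatePoint_eq_of_one_le_norm hq0 hq hns hx'
    refine ⟨w * v, ?_⟩
    rw [tatePoint_mul hX hY hq0 hq, hw, ← hsum, neg_add_cancel_right]

end Literature.NumberTheory.EllipticCurves.TateCurve

end
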